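import Summits.AnomalousDissipation.AnomalousDissipation.Theorems.BaireTransferRobustLoudUpgradeLine
import Summits.AnomalousDissipation.AnomalousDissipation.Theorems.BaireTransferRobustLoudUpgradeStubSteadyPersist
import Summits.AnomalousDissipation.AnomalousDissipation.Theorems.BaireTransferRobustLoudUpgradeStubPeriodicWindow
import Summits.AnomalousDissipation.AnomalousDissipation.Theorems.BaireTransferRobustLoudUpgradePeriodicPersistOfHenry
import Literature.Analysis.FluidPDE.PeriodicNSOrbitPersistsProofs
import Literature.Analysis.FluidPDE.LongTimeAverageNonneg

/-!
# Stub `stub_orbitInW` of the line `malkin-cone-group-orbits`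
# (crux stmt-AnomalousDissipation-1144, `BaireTransfer.RobustLoudUpgrade`, lead c16, lattice-tempered windows)

A classical `τ`-periodic solution `u` of `NS_ν(f_c)` with the trigonometric-polynomial force
`force S c` (any mean `m₀ = ∫ u(0)`) gives the element `x₀ = Λ·û` of the lattice state space
`W ⊂ ℓ²(ℤ × ℤ³; ℂ³)` (`û = 𝐨[τ, u]` the space–time Fourier data of `timeRoll τ u − m₀`; `W` the
closed subspace of families vanishing on the zero spatial modes, transversal and conjugate symmetric),
and `û` solves the projected lattice equation
`σ_{τ⁻¹,ν,m₀}(m) û(m) + Π_k N(û,û)(m) = y_{f_c}(m)` for `k ≠ 0`.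

This is exactly the first block of `TimePeriodicLattice.persists_main`
(`Literature/Analysis/FluidPDE/PeriodicNSOrbitPersistsProofs.lean`) together with
`TimePeriodicLattice.orbit_equation` (`Literature/Analysis/FluidPDE/TimePeriodicNSLatticeOrbit.lean`);
the force facts are `SteadyPersist.hasZeroMean_force'`, `SteadyPersist.isDivFree_force'`.

References: G. Iooss, Arch. Rational Mech. Anal. 47 (1972), §2–3; D. Henry, LNM 840 (1981), Thm. 8.3.2;
H. Kielhöfer, *Bifurcation Theory* (2012), §I.8. Pure proof file (no definitions).
-/

set_option linter.dupNamespace false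

noncomputable section

open scoped BigOperators Topology ENNReal NNReal ComplexConjugate
open Filter Set Function TopologicalSpace MeasureTheory UnitAddTorus

namespace Summit.AnomalousDissipation.AnomalousDissipation.Theorems.RobustLoudUpgrade.Tempered

open Literature.Analysis.FunctionSpaces Literature.Analysis.FunctionSpaces.Torus
open Literature.Analysis.FunctionSpaces.EuclideanSpace
open Literature.Analysis.FluidPDE Literature.Analysis.FluidPDE.ScalarFourier
open Literature.Analysis.FluidPDE.TimePeriodicLattice
open Summit.AnomalousDissipation.AnomalousDissipation.Theses.BaireTransfer
open Summit.AnomalousDissipation.AnomalousDissipation.Theorems.RobustLoudUpgrade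

-- NOTATION START (verbatim the local notations of `Literature/Analysis/FluidPDE/PeriodicNSOrbitPersistsProofs.lean`)
/-- The flat unit torus `T³`. -/
local notation "𝕋³" => UnitAddTorus (Fin 3)
/-- Real velocity values. -/
local notation "ℝ³" => EuclideanSpace ℝ (Fin 3)
/-- Complex coefficient values. -/
local notation "ℂ³" => EuclideanSpace ℂ (Fin 3)

/-- Local notation: the parabolic weight `Λ(n, k) = |n| + |k|²`. -/
local notation:max "Λ" m:max => (|((Prod.fst m : ℤ) : ℝ)| + freqNormSq (Prod.snd m))

/-- Local notation: the convective symbol on `ℤ × ℤ³` (as in `TimePeriodicNSLattice`). -/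
local notation:max "𝐍[" a ", " b "]" m:max =>
  (WithLp.toLp 2 (fun p : Fin 3 => ∑ j : Fin 3, ∑' m' : ℤ × (Fin 3 → ℤ),
    a m' j * (dsym j (Prod.snd m - Prod.snd m') * b (m - m') p)) : EuclideanSpace ℂ (Fin 3))

/-- Local notation: division by the weight. -/
local notation:max "𝐜" x:max => (fun mm : ℤ × (Fin 3 → ℤ) =>
  ((((|((Prod.fst mm : ℤ) : ℝ)| + freqNormSq (Prod.snd mm))⁻¹ : ℝ) : ℂ) • x mm))

/-- Local notation: multiplication by the weight. -/
local notation:max "𝐬" x:max => (fun mm : ℤ × (Fin 3 → ℤ) =>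
  ((((|((Prod.fst mm : ℤ) : ℝ)| + freqNormSq (Prod.snd mm)) : ℝ) : ℂ) • x mm))

/-- Local notation: the family of coefficients of `x ∈ W ⊂ ℓ²`. -/
local notation:max "𝐰" x:max =>
  (((x : lp (fun _ : ℤ × (Fin 3 → ℤ) => EuclideanSpace ℂ (Fin 3)) 2)) : ℤ × (Fin 3 → ℤ) → EuclideanSpace ℂ (Fin 3))

/-- Local notation: the symbol `σ_om(n,k) = 2πi om n + 4π²ν|k|² + 2πi m₀·k`. -/
local notation "σ[" om ", " ν ", " m₀ "]" => (fun mm : ℤ × (Fin 3 → ℤ) =>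
  2 * Real.pi * Complex.I * ((om : ℝ) : ℂ) * ((Prod.fst mm : ℤ) : ℂ) +
    (((4 * Real.pi ^ 2 * ν * freqNormSq (Prod.snd mm) : ℝ)) : ℂ) +
    2 * Real.pi * Complex.I * (∑ jj : Fin 3, ((m₀ jj : ℝ) : ℂ) * (((Prod.snd mm) jj : ℤ) : ℂ)))

/-- Local notation: the lattice family of the orbit `u` with period `τ`:
`û(n,k) = 𝓕(complexify ∘ (timeRoll τ u − ∫ u(0)))(n,k)`. -/
local notation:max "𝐨[" τ ", " u "]" => (fun mm : ℤ × (Fin 3 → ℤ) =>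
  mFourierCoeff (EuclideanSpace.complexify ∘ fun y : UnitAddTorus (Fin 4) => Torus.timeRoll τ u y - ∫ x, u 0 x)
    (Fin.cons (Prod.fst mm) (Prod.snd mm) : Fin 4 → ℤ))

/-- Local notation: the force family `y_F(n,k) = [k ≠ 0][n = 0] 𝓕(complexify ∘ F)(k)`. -/
local notation:max "𝐲" F:max => (fun mm : ℤ × (Fin 3 → ℤ) =>
  (ite (Prod.snd mm = 0) (0 : EuclideanSpace ℂ (Fin 3))
    (ite (Prod.fst mm = 0) (mFourierCoeff (EuclideanSpace.complexify ∘ F) (Prod.snd mm)) 0)))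
-- NOTATION END

variable {W : Submodule ℝ (lp (fun _ : ℤ × (Fin 3 → ℤ) => EuclideanSpace ℂ (Fin 3)) 2)}

-- adapted from Literature/Analysis/FluidPDE/PeriodicNSOrbitPersistsProofs.lean (`persists_main`, first block)
/-- **The orbit as an element of `W` and its lattice equation.** A classical `τ`-periodic solution
`u` of `NS_ν(f_c)` gives `x₀ ∈ W` with coefficients `Λ·û`, `û = 𝐨[τ, u]`, and `û` solves the
projected lattice equation `σ_{τ⁻¹,ν,∫u(0)}(m) û(m) + Π_k N(û,û)(m) = y_{f_c}(m)` for `k ≠ 0`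
(Iooss 1972, §2; Kielhöfer 2012, (I.8.9)–(I.8.15)). [folklore] -/
theorem stub_orbitInW
    (hW : ∀ x : lp (fun _ : ℤ × (Fin 3 → ℤ) => EuclideanSpace ℂ (Fin 3)) 2, x ∈ W ↔
      (∀ n : ℤ, (x : ℤ × (Fin 3 → ℤ) → EuclideanSpace ℂ (Fin 3)) (n, 0) = 0) ∧
      (∀ mm : ℤ × (Fin 3 → ℤ), (∑ jj : Fin 3, ((mm.2 jj : ℤ) : ℂ) *
        ((x : ℤ × (Fin 3 → ℤ) → EuclideanSpace ℂ (Fin 3)) mm) jj) = 0) ∧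
      (∀ mm : ℤ × (Fin 3 → ℤ), (x : ℤ × (Fin 3 → ℤ) → EuclideanSpace ℂ (Fin 3)) (-mm) =
        conjVec ((x : ℤ × (Fin 3 → ℤ) → EuclideanSpace ℂ (Fin 3)) mm)))
    {S : Finset (Fin 3 → ℤ)} (c : Coeff S) {ν τ : ℝ} (hτ : 0 < τ)
    {u : ℝ → 𝕋³ → ℝ³} {p : ℝ → 𝕋³ → ℝ}
    (hsol : IsClassicalNSSolutionOn Set.univ ν (fun _ => force S c) u p) (hper : Function.Periodic u τ) :
    ∃ x₀ : W, 𝐰 x₀ = 𝐬 𝐨[τ, u] ∧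
      ∀ m : ℤ × (Fin 3 → ℤ), m.2 ≠ 0 →
        σ[τ⁻¹, ν, ∫ x, u 0 x] m • 𝐨[τ, u] m + Torus.lerayCoeff m.2 (𝐍[𝐨[τ, u], 𝐨[τ, u]] m) =
          (𝐲 (force S c)) m := by
  have hf0 : HasZeroMean (force S c) := SteadyPersist.hasZeroMean_force' c
  have hfd : IsDivFree (force S c) := SteadyPersist.isDivFree_force' c
  -- the lattice data of the orbit
  have hu0 : ∀ n : ℤ, 𝐨[τ, u] ((n, 0) : ℤ × (Fin 3 → ℤ)) = 0 := orbit_zero_modes hsol hper hf0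
  have hut := orbit_transversal hsol hper
  have huc := orbit_conj hsol hper
  have hur := orbit_rapidDecay hsol hper
  have hx₀2 : ∑' m : ℤ × (Fin 3 → ℤ), ‖(𝐬 (𝐨[τ, u])) m‖ₑ ^ 2 ≠ ⊤ := by
    have := moments_of_rapidDecay (C := mFourierCoeff (complexify ∘ fun y => timeRoll τ u y - ∫ x, u 0 x)) hur 0
    simpa only [pow_zero, ENNReal.ofReal_one, one_mul] using this
  -- the element of `W`
  obtain ⟨x₀, hx₀⟩ := exists_memW hW (v := 𝐬 (𝐨[τ, u])) hx₀2 (sw_zero_mode (x := 𝐨[τ, u]) hu0)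
    (sw_transversal (x := 𝐨[τ, u]) hut) (sw_neg (x := 𝐨[τ, u]) huc)
  refine ⟨x₀, hx₀, fun m hm => ?_⟩
  -- the projected lattice equation
  rw [yf_of_snd_ne_zero (force S c) hm]
  exact orbit_equation hsol hper hτ hfd m hm

end Summit.AnomalousDissipation.AnomalousDissipation.Theorems.RobustLoudUpgrade.Tempered

end
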